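import Summits.BirchSwinnertonDyer.BirchSwinnertonDyer.Theorems.InertBadSignedBranchesLeafOfKMCPerrinRiou
import Summits.BirchSwinnertonDyer.Rank1Residual.Additive.KodairaDictionaryThree
import Summits.BirchSwinnertonDyer.Rank1Residual.Additive.GordTwistMinimalModel
import Summits.BirchSwinnertonDyer.Rank1Residual.GaloisImage.TameThreeKodairaShapeInt
import Summits.BirchSwinnertonDyer.Rank1Residual.X12.InertBadKodairaTypes
import HarnessLib

/-!
# Route `InertBadSignedBranches` (rung K8-inert, cell bsd-cm): the two HELD residuals OFF the signed
# type `I₀*` — `InertBadAtThreeOffIstarZero` (stmt-BirchSwinnertonDyer-19657, `p = 3`) and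
# `InertBadOffType` (stmt-BirchSwinnertonDyer-19224, `p ≥ 5`) — ARE the CM-inert rows of the census
# cell (t′) in analytic rank one (a `--supports 19657` helper; seat bsd-cm-k8i-c42 g12; theorems only)

PARTITION (D-0054): CornerF-inert (B12/O10) × O10 off `I₀*` = O10-SC@3 (`{y² = x³ + Ax : ord₃ A odd}`,
signed types `(3, III)`/`(3, III*)`, 97 census classes) ⊔ O10-SC at `p ≥ 5` (`j ∈ {0, 1728}`, signed types
`II, IV, IV*, II*` at `p ≡ 2 (3)` / `III, III*` at `p ≡ 3 (4)`) × `p` — types-the-object-of: the corner is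
placed INSIDE the additive census cell (t′) of `Additive/SharpenedStatements.lean` (`SubTprime W p`: not
potentially multiplicative, `f_p = 2`, semistability defect `e ∤ p − 1`), and conversely the CM-inert (t′)
rows are exactly this corner. Closes no cell and no item; moves no label; BSD is not advanced by any of this.

WHY. The sibling cell bsd-potss runs the route `KatoDescentTamePotSupersingular` (rung K8-t′) on the cell
(t′) at every odd `p`; its declared analytic-rank-ONE residual `TameRankOne` (stmt-BirchSwinnertonDyer-19984)
reads `∀ W p, r_an(W) = 1 → p ≠ 2 → Addv W p → SubTprime W p → MissingPPartAt W p`. This file proves, in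
the K8 cone alone (no import of that route file), that the conjunction of the two K8-inert HELD residuals is
EQUIVALENT to the CM-inert rows of that body (§3, the body written inline):
`(InertBadOffType ∧ InertBadAtThreeOffIstarZero) ⟺ (∀ W p, W CM, p inert in the CM field, r_an = 1, p ≠ 2,
Addv W p, SubTprime W p ⟹ X12.MissingInputAt W p)`. The by-name dominations `TameRankOne ⟹ 19657`,
`TameRankOne ⟹ 19224` are the three-line corollaries of the sequel file
`InertBadSignedBranchesInertBadOffCornerOfTameRankOne.lean` (which imports both route files). Consequence for
the ledger's residual bookkeeping (LADDER-BSD): the residual rows 19657 and 19224 are SUB-ROWS of 19984, not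
independent residual mass; closing 19984 closes both by name; the converse needs the non-CM and the
CM-ramified (t′) rows, which no K8-inert item speaks about.

## Contents
* §0 places of `ℚ` over `p` (existence/uniqueness over `𝓞 ℚ`; the census place `placeOf p` over `ℤ`,
  tree `Additive.natGenerator_placeOf_eq`; transport of Kodaira symbols between them, tree
  `GaloisImage.kodairaSymbolAt_eq_of_natGenerator_eq`).
* §1 `p = 3`: `subTprime_three_of_offIstarZero` — on the off-`I₀*` inert-bad corner at `3` (signed type
  `(3, III)` or `(3, III*)`, seat g0's `j_eq_1728_and_hasSignedLocalType_of_offIstarZero`) the pair is (t′),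
  by the b2b dictionary `Additive.subTprime_three_iff_kodairaSymbolAt_III_or_IIIstar`; conversely a CM-inert
  (t′) pair at `3` is off `I₀*` (`not_hasSignedLocalType_IstarZero_three_of_subTprime`).
* §2 `p ≥ 5`: `subTprime_of_offIstarZero_of_five_le` — x1b's Kodaira classification of CM curves at an
  unramified `p ≥ 5` (`X12.hasGoodReductionAt_or_kodairaSymbolAt_of_hasCM`: `j = 0`, `T ∈ {II, IV, I₀*, IV*,
  II*}`; `j = 1728`, `T ∈ {III, I₀*, III*}`; else `I₀*`) + the additive valuation table
  `Additive.kodairaSymbolAt_placeOf_cases_of_addv` (`ord_p Δ_min = m_p + 1`) give `e ∈ {3, 6}` at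
  `p ≡ 2 (3)` resp. `e = 4` at `p ≡ 3 (4)` (`X12.cmInert_iff_mod_…`), so `e ∤ p − 1`; `f_p = 2` is
  `Additive.condExpTwo_of_addv_of_five_le`; `ord_p j ≥ 0` for CM. Conversely (t′) excludes `I₀*` (`e = 2`).
* §3 the partition statement `inertBadOff_iff_tprimeCMInertRows` and its two directions.

HONEST LABEL. Pure bookkeeping between typed predicates; every theorem is unconditional; nothing is booked;
both items stay HELD/open (their content is BSD_p in analytic rank one at an inert additive potentially
supersingular prime of a CM curve — no source in print, seat memos g0–g10).
References: [SilvermanATAEC1994] IV.9.4 and Table 4.1 (PDF p. 365), App. A §3; [SilvermanAEC2009] App. C §11;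
[Cox2013] Prop. 5.16 / Cor. 5.17; [Miller2011LMS] Def. 1.1.
-/

set_option autoImplicit false
set_option linter.dupNamespace false

noncomputable section

open scoped Classical NumberField

open WeierstrassCurve NumberField IsDedekindDomain IsDedekindDomain.HeightOneSpectrum Rat.HeightOneSpectrum
open Literature.NumberTheory.EllipticCurves
open Literature.NumberTheory.EllipticCurves.Rank1Residual
open Literature.NumberTheory.EllipticCurves.Rank1Residual.Typed
open Literature.NumberTheory.DiophantineGeometry (KodairaSymbol)
open Summit.BirchSwinnertonDyer.Rank1Residual
open Summit.BirchSwinnertonDyer.Rank1Residual.Additive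
open Summit.BirchSwinnertonDyer.Rank1Residual.X12.O10
open Summit.BirchSwinnertonDyer.BirchSwinnertonDyer.Theses.InertBadSignedBranches
open Summit.BirchSwinnertonDyer.BirchSwinnertonDyer.Theorems.InertBadOffLowerHalf
open Summit.BirchSwinnertonDyer.BirchSwinnertonDyer.Theorems.InertBadLeafKMCPerrinRiou

namespace Summit.BirchSwinnertonDyer.BirchSwinnertonDyer.Theorems.InertBadOffTprime

/-! ## §0 Places over `p`: the place of `𝓞 ℚ` and the census place `placeOf p` of `ℤ` -/

section Places

variable (p : ℕ) [hp : Fact p.Prime]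

/-- There is a place of `𝓞 ℚ` over `p` (Mathlib's `Rat.HeightOneSpectrum.primesEquiv`). [folklore] -/
theorem exists_place : ∃ v : HeightOneSpectrum (𝓞 ℚ), natGenerator v = p :=
  ⟨(primesEquiv (R := 𝓞 ℚ)).symm ⟨p, hp.out⟩,
    congrArg Subtype.val ((primesEquiv (R := 𝓞 ℚ)).apply_symm_apply ⟨p, hp.out⟩)⟩

/-- **The Kodaira symbol at a place `v ∣ p` of `𝓞 ℚ` is the census symbol at `placeOf p`** (both are
Tate's algorithm over `ℤ_p`; tree `GaloisImage.kodairaSymbolAt_eq_of_natGenerator_eq` and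
`Additive.natGenerator_placeOf_eq`). [folklore] -/
theorem kodairaSymbolAt_eq_placeOf (W : WeierstrassCurve ℚ) [W.IsElliptic] (v : HeightOneSpectrum (𝓞 ℚ))
    (hv : natGenerator v = p) : W.kodairaSymbolAt v = W.kodairaSymbolAt (placeOf p) :=
  GaloisImage.kodairaSymbolAt_eq_of_natGenerator_eq v (placeOf p) (hv.trans (natGenerator_placeOf_eq p).symm) W

/-- A signed local type at `p` is read off ANY (= the one) place of `𝓞 ℚ` over `p` (the `p`-generic
form of seat g0's `hasSignedLocalType_three_iff`). Bookkeeping. [folklore] -/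
theorem hasSignedLocalType_iff_of_natGenerator_eq (W : WeierstrassCurve ℚ) [W.IsElliptic]
    (T : KodairaSymbol) (v : HeightOneSpectrum (𝓞 ℚ)) (hv : natGenerator v = p) :
    HasSignedLocalType W p T ↔ W.HasCM ∧ CMInert W p ∧ ¬ Good W p ∧ W.kodairaSymbolAt v = T := by
  refine ⟨fun ⟨hCM, hin, hbad, hk⟩ ↦ ⟨hCM, hin, hbad, hk v hv⟩,
    fun ⟨hCM, hin, hbad, hk⟩ ↦ ⟨hCM, hin, hbad, fun w hw ↦ ?_⟩⟩
  rw [place_eq_of_natGenerator_eq (hw.trans hv.symm), hk]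

/-- **The signed local type in census coordinates**: `HasSignedLocalType W p T` iff `W` is CM, `p` inert
in the CM field, `W` bad at `p`, and the Kodaira symbol at the census place `placeOf p` is `T`.
[cite: SilvermanATAEC1994, IV.9.4 and Table 4.1] -/
theorem hasSignedLocalType_iff_placeOf (W : WeierstrassCurve ℚ) [W.IsElliptic] (T : KodairaSymbol) :
    HasSignedLocalType W p T ↔
      W.HasCM ∧ CMInert W p ∧ ¬ Good W p ∧ W.kodairaSymbolAt (placeOf p) = T := by
  obtain ⟨v, hv⟩ := exists_place p
  rw [hasSignedLocalType_iff_of_natGenerator_eq p W T v hv, kodairaSymbolAt_eq_placeOf p W v hv]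

end Places

/-! ## §1 `p = 3`: the off-`I₀*` inert-bad corner is the CM-inert part of the cell (t′) -/

section Three

variable (W : WeierstrassCurve ℚ) [W.IsElliptic]

/-- A CM curve bad at `p` is ADDITIVE at `p` (CM curves are never multiplicative: integral `j`).
[cite: SilvermanATAEC1994, Thm. II.6.4] -/
theorem addv_of_hasCM_of_not_good (p : ℕ) [Fact p.Prime] (hCM : W.HasCM) (hbad : ¬ Good W p) :
    Addv W p :=
  ⟨hbad, not_mult_of_hasCM W hCM p⟩

/-- On the off-`I₀*` inert-bad corner at `3` the census Kodaira symbol is `III` or `III*` (seat g0's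
shape theorem, transported to `placeOf 3`). [cite: SilvermanATAEC1994, IV.9.4, Table 4.1 and App. A §3] -/
theorem kodairaSymbolAt_placeOf_three_of_offIstarZero [Fact (Nat.Prime 3)] (hCM : W.HasCM)
    (hin : CMInert W 3) (hbad : ¬ Good W 3) (hnT : ¬ HasSignedLocalType W 3 (.Istar 0)) :
    W.kodairaSymbolAt (placeOf 3) = .III ∨ W.kodairaSymbolAt (placeOf 3) = .IIIstar := by
  rcases (j_eq_1728_and_hasSignedLocalType_of_offIstarZero W hCM hin hbad hnT).2 with h | h
  · exact Or.inl ((hasSignedLocalType_iff_placeOf 3 W _).mp h).2.2.2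
  · exact Or.inr ((hasSignedLocalType_iff_placeOf 3 W _).mp h).2.2.2

/-- **The off-`I₀*` inert-bad corner at `3` lies in the census cell (t′)** (`SubTprime W 3`: not potentially
multiplicative, `f₃ = 2`, `e = 4 ∤ 2`), by the b2b dictionary (t′)@3 ⟺ Kodaira `III`/`III*`.
[cite: SilvermanATAEC1994, IV.9.4 Steps 4, 9 and Table 4.1 (PDF pp. 344–346, 365)] -/
theorem subTprime_three_of_offIstarZero [W.IsGloballyMinimal] [Fact (Nat.Prime 3)] (hCM : W.HasCM)
    (hin : CMInert W 3) (hbad : ¬ Good W 3) (hnT : ¬ HasSignedLocalType W 3 (.Istar 0)) :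
    SubTprime W 3 :=
  (subTprime_three_iff_kodairaSymbolAt_III_or_IIIstar W (addv_of_hasCM_of_not_good W 3 hCM hbad)).mpr
    (kodairaSymbolAt_placeOf_three_of_offIstarZero W hCM hin hbad hnT)

/-- **Conversely, a (t′) pair at `3` is NOT of signed local type `(3, I₀*)`** (`I₀*` at `3` is the cell
(G-ord), `e = 2`). [cite: SilvermanATAEC1994, IV.9.4 Step 6 and Table 4.1 (PDF pp. 345, 365)] -/
theorem not_hasSignedLocalType_IstarZero_three_of_subTprime [W.IsGloballyMinimal] [Fact (Nat.Prime 3)]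
    (hadd : Addv W 3) (hT : SubTprime W 3) : ¬ HasSignedLocalType W 3 (.Istar 0) := by
  intro h0
  have hk : W.kodairaSymbolAt (placeOf 3) = .Istar 0 := ((hasSignedLocalType_iff_placeOf 3 W _).mp h0).2.2.2
  rcases (subTprime_three_iff_kodairaSymbolAt_III_or_IIIstar W hadd).mp hT with h | h <;>
    rw [hk] at h <;> exact absurd h (by decide)

end Three

/-! ## §2 `p ≥ 5`: the off-`I₀*` inert-bad corner is the CM-inert part of the cell (t′) -/

section FiveLe

variable (W : WeierstrassCurve ℚ) [W.IsElliptic] [W.IsGloballyMinimal] (p : ℕ) [hp : Fact p.Prime]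

/-- `ord_p Δ_min = m_p + 1` read at a given census symbol (additive `p ≥ 5`). Bookkeeping over
`Additive.padicValInt_minimalDiscriminantInt_eq_numComponents_add_one`.
[cite: SilvermanATAEC1994, IV Table 4.1 (PDF p. 365)] -/
theorem padicValInt_minimalDiscriminantInt_of_kodairaSymbolAt (hp5 : 5 ≤ p) (hadd : Addv W p)
    {T : KodairaSymbol} (hT : W.kodairaSymbolAt (placeOf p) = T) :
    padicValInt p W.minimalDiscriminantInt = T.numComponents + 1 := by
  rw [padicValInt_minimalDiscriminantInt_eq_numComponents_add_one W p hp5 hadd, hT]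

/-- **At a CM-inert additive `p ≥ 5` off `I₀*` the semistability defect does not divide `p − 1`**:
`j = 0`, `p ≡ 2 (3)`, `T ∈ {II, IV, IV*, II*}`, `e ∈ {6, 3, 3, 6}`; or `j = 1728`, `p ≡ 3 (4)`,
`T ∈ {III, III*}`, `e = 4`. [cite: SilvermanATAEC1994, IV.9.4, Table 4.1 and App. A §3]
[cite: Cox2013, Prop. 5.16 and Cor. 5.17] -/
theorem not_semistabilityIndex_dvd_of_offIstarZero_of_five_le (hp5 : 5 ≤ p) (hCM : W.HasCM)
    (hin : CMInert W p) (hbad : ¬ Good W p) (hnT : ¬ HasSignedLocalType W p (.Istar 0)) :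
    ¬ semistabilityIndex W p ∣ p - 1 := by
  have hadd : Addv W p := addv_of_hasCM_of_not_good W p hCM hbad
  obtain ⟨v, hv⟩ := exists_place p
  have hbad' : ¬ W.HasGoodReductionAt v := by rwa [← X12.good_iff_hasGoodReductionAt W p v hv]
  have hne : W.kodairaSymbolAt (placeOf p) ≠ .Istar 0 := fun h ↦
    hnT ((hasSignedLocalType_iff_placeOf p W _).mpr ⟨hCM, hin, hbad, h⟩)
  have htr : W.kodairaSymbolAt v = W.kodairaSymbolAt (placeOf p) := kodairaSymbolAt_eq_placeOf p W v hv
  have hp2 : p ≠ 2 := by omega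
  have hp3 : p ≠ 3 := by omega
  have hclass := X12.hasGoodReductionAt_or_kodairaSymbolAt_of_hasCM W hCM v (hv.symm ▸ hp5)
    (hv.symm ▸ hin.1)
  rw [htr] at hclass
  intro hdvd
  unfold semistabilityIndex at hdvd
  rcases hclass with hgood | ⟨hj, hk⟩ | ⟨hj, hk⟩ | ⟨-, -, hk⟩
  · exact hbad' hgood
  · -- `j = 0`: `p ≡ 2 (mod 3)`, symbol `II, IV, I₀*, IV*, II*`
    have hmod : p % 3 = 2 := (X12.cmInert_iff_mod_three_eq_two_of_j_eq_zero W p hp2 hp3 hj).mp hin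
    rcases hk with hk | hk | hk | hk | hk
    · rw [padicValInt_minimalDiscriminantInt_of_kodairaSymbolAt W p hp5 hadd hk] at hdvd
      simp only [KodairaSymbol.numComponents, Nat.reduceAdd, Nat.reduceGcd, Nat.reduceDiv] at hdvd
      omega
    · rw [padicValInt_minimalDiscriminantInt_of_kodairaSymbolAt W p hp5 hadd hk] at hdvd
      simp only [KodairaSymbol.numComponents, Nat.reduceAdd, Nat.reduceGcd, Nat.reduceDiv] at hdvd
      omega
    · exact hne hk
    · rw [padicValInt_minimalDiscriminantInt_of_kodairaSymbolAt W p hp5 hadd hk] at hdvd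
      simp only [KodairaSymbol.numComponents, Nat.reduceAdd, Nat.reduceGcd, Nat.reduceDiv] at hdvd
      omega
    · rw [padicValInt_minimalDiscriminantInt_of_kodairaSymbolAt W p hp5 hadd hk] at hdvd
      simp only [KodairaSymbol.numComponents, Nat.reduceAdd, Nat.reduceGcd, Nat.reduceDiv] at hdvd
      omega
  · -- `j = 1728`: `p ≡ 3 (mod 4)`, symbol `III, I₀*, III*`
    have hmod : p % 4 = 3 := (X12.cmInert_iff_mod_four_eq_three_of_j_eq_1728 W p hp2 hj).mp hin
    rcases hk with hk | hk | hk
    · rw [padicValInt_minimalDiscriminantInt_of_kodairaSymbolAt W p hp5 hadd hk] at hdvd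
      simp only [KodairaSymbol.numComponents, Nat.reduceAdd, Nat.reduceGcd, Nat.reduceDiv] at hdvd
      omega
    · exact hne hk
    · rw [padicValInt_minimalDiscriminantInt_of_kodairaSymbolAt W p hp5 hadd hk] at hdvd
      simp only [KodairaSymbol.numComponents, Nat.reduceAdd, Nat.reduceGcd, Nat.reduceDiv] at hdvd
      omega
  · exact hne hk

/-- **The off-`I₀*` inert-bad corner at `p ≥ 5` lies in the census cell (t′)** (`SubTprime W p`):
`ord_p j ≥ 0` (CM), `f_p = 2` (additive, `p ≥ 5`), `e ∤ p − 1` (previous lemma).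
[cite: SilvermanATAEC1994, IV.9.4, Table 4.1, IV.10.4 and App. A §3] [cite: SilvermanAEC2009, App. C §11] -/
theorem subTprime_of_offIstarZero_of_five_le (hp5 : 5 ≤ p) (hCM : W.HasCM) (hin : CMInert W p)
    (hbad : ¬ Good W p) (hnT : ¬ HasSignedLocalType W p (.Istar 0)) : SubTprime W p :=
  ⟨fun hj ↦ absurd hj (not_lt.mpr (padicValRat_j_nonneg_of_hasCM W p hCM)),
    condExpTwo_of_addv_of_five_le W p hp5 (addv_of_hasCM_of_not_good W p hCM hbad),
    not_semistabilityIndex_dvd_of_offIstarZero_of_five_le W p hp5 hCM hin hbad hnT⟩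

/-- **Conversely, a (t′) pair at `p ≥ 5` is NOT of signed local type `(p, I₀*)`** (`I₀*`: `ord_p Δ_min = 6`,
`e = 2 ∣ p − 1`). [cite: SilvermanATAEC1994, IV Table 4.1 (PDF p. 365)] -/
theorem not_hasSignedLocalType_IstarZero_of_subTprime_of_five_le (hp5 : 5 ≤ p) (hadd : Addv W p)
    (hT : SubTprime W p) : ¬ HasSignedLocalType W p (.Istar 0) := by
  intro h0
  have hk : W.kodairaSymbolAt (placeOf p) = .Istar 0 := ((hasSignedLocalType_iff_placeOf p W _).mp h0).2.2.2
  apply hT.2.2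
  unfold semistabilityIndex
  rw [padicValInt_minimalDiscriminantInt_of_kodairaSymbolAt W p hp5 hadd hk]
  simp only [KodairaSymbol.numComponents, Nat.reduceAdd, Nat.reduceGcd, Nat.reduceDiv]
  have hodd : p % 2 = 1 := Nat.odd_iff.mp (hp.out.odd_of_ne_two (by omega))
  omega

end FiveLe

/-! ## §3 The partition statement: the two K8-inert HELD residuals off `I₀*` ⟺ the CM-inert rows of
the cell (t′) in analytic rank one -/

/-- **CM-inert (t′) rows, analytic rank one ⟹ the two K8-inert residuals off `I₀*`.** The hypothesis is
the body of bsd-potss's residual `KatoDescentTamePotSupersingular.TameRankOne` (item 19984) RESTRICTED to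
CM curves at a prime inert in the CM field, with the K8 conclusion `X12.MissingInputAt` (whose Li–Liu–Tian
clause is void at an inert prime) — written inline so that this file stays in the K8 cone.
[cite: SilvermanATAEC1994, IV.9.4 and Table 4.1] [cite: Miller2011LMS, Def. 1.1] -/
theorem inertBadOff_of_tprimeCMInertRows
    (h : ∀ (W : WeierstrassCurve ℚ) [W.IsElliptic] [W.IsGloballyMinimal] (p : ℕ) [Fact p.Prime],
      W.HasCM → CMInert W p → W.analyticRank = 1 → p ≠ 2 → Addv W p → SubTprime W p →
        X12.MissingInputAt W p) :
    InertBadOffType ∧ InertBadAtThreeOffIstarZero := by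
  refine ⟨?_, ?_⟩
  · intro W _ _ p _ hCM hr hin hbad hp5 hnT
    exact h W p hCM hin hr (by omega) (addv_of_hasCM_of_not_good W p hCM hbad)
      (subTprime_of_offIstarZero_of_five_le W p hp5 hCM hin hbad hnT)
  · intro W _ _ _ hCM hr hin hbad hnT
    exact h W 3 hCM hin hr (by decide) (addv_of_hasCM_of_not_good W 3 hCM hbad)
      (subTprime_three_of_offIstarZero W hCM hin hbad hnT)

/-- An odd prime is `3` or at least `5`. [folklore] -/
theorem eq_three_or_five_le_of_prime_of_ne_two {p : ℕ} (hp : p.Prime) (hp2 : p ≠ 2) : p = 3 ∨ 5 ≤ p := by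
  rcases Nat.lt_or_ge p 5 with hlt | hge
  · left
    interval_cases p
    · exact absurd hp Nat.not_prime_zero
    · exact absurd hp Nat.not_prime_one
    · exact absurd rfl hp2
    · rfl
    · exact absurd hp (by decide)
  · exact Or.inr hge

/-- **The two K8-inert residuals off `I₀*` ⟹ the CM-inert (t′) rows in analytic rank one** (at `p = 3`
a CM-inert (t′) pair is off `I₀*` by §1, at `p ≥ 5` by §2; `p ≠ 2` and prime ⟹ `p = 3 ∨ p ≥ 5`).
[cite: SilvermanATAEC1994, IV.9.4 and Table 4.1] [cite: Miller2011LMS, Def. 1.1] -/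
theorem tprimeCMInertRows_of_inertBadOff (h5 : InertBadOffType) (h3 : InertBadAtThreeOffIstarZero)
    (W : WeierstrassCurve ℚ) [W.IsElliptic] [W.IsGloballyMinimal] (p : ℕ) [hp : Fact p.Prime]
    (hCM : W.HasCM) (hin : CMInert W p) (hr : W.analyticRank = 1) (hp2 : p ≠ 2) (hadd : Addv W p)
    (hT : SubTprime W p) : X12.MissingInputAt W p := by
  rcases eq_three_or_five_le_of_prime_of_ne_two hp.out hp2 with h | hp5
  · subst h
    exact h3 W hCM hr hin hadd.1 (not_hasSignedLocalType_IstarZero_three_of_subTprime W hadd hT)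
  · exact h5 W p hCM hr hin hadd.1 hp5
      (not_hasSignedLocalType_IstarZero_of_subTprime_of_five_le W p hp5 hadd hT)

/-- **PARTITION STATEMENT.** The conjunction of the two K8-inert HELD residuals off the signed type `I₀*`
(`InertBadOffType`, item 19224, `p ≥ 5`; `InertBadAtThreeOffIstarZero`, item 19657, `p = 3`) is
EQUIVALENT to the CM-inert rows, in analytic rank one, of the additive census cell (t′) — i.e. to the
CM-inert rows of bsd-potss's residual `TameRankOne` (item 19984) read with the K8 conclusion. Unconditional;
closes nothing. [cite: SilvermanATAEC1994, IV.9.4 and Table 4.1] [cite: Miller2011LMS, Def. 1.1] -/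
theorem inertBadOff_iff_tprimeCMInertRows :
    (InertBadOffType ∧ InertBadAtThreeOffIstarZero) ↔
      ∀ (W : WeierstrassCurve ℚ) [W.IsElliptic] [W.IsGloballyMinimal] (p : ℕ) [Fact p.Prime],
        W.HasCM → CMInert W p → W.analyticRank = 1 → p ≠ 2 → Addv W p → SubTprime W p →
          X12.MissingInputAt W p :=
  ⟨fun ⟨h5, h3⟩ W _ _ p _ hCM hin hr hp2 hadd hT ↦
      tprimeCMInertRows_of_inertBadOff h5 h3 W p hCM hin hr hp2 hadd hT,
    inertBadOff_of_tprimeCMInertRows⟩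

/-- **… and in `MissingPPartAt` currency** (the typed output of the tame rank-one body verbatim): at an
inert `p` the Li–Liu–Tian clause of `X12.MissingInputAt` is void, so the two currencies agree row by row.
[cite: LiLiuTian2024, Thm. 1.1 (i) (shape only)] [cite: Miller2011LMS, Def. 1.1] -/
theorem inertBadOff_iff_tprimeCMInertRows' :
    (InertBadOffType ∧ InertBadAtThreeOffIstarZero) ↔
      ∀ (W : WeierstrassCurve ℚ) [W.IsElliptic] [W.IsGloballyMinimal] (p : ℕ) [Fact p.Prime],
        W.HasCM → CMInert W p → W.analyticRank = 1 → p ≠ 2 → Addv W p → SubTprime W p →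
          MissingPPartAt W p := by
  rw [inertBadOff_iff_tprimeCMInertRows]
  refine ⟨fun h W _ _ p _ hCM hin hr hp2 hadd hT ↦ h W p hCM hin hr hp2 hadd hT
      (not_cmSplit_of_cmInert W p hin),
    fun h W _ _ p _ hCM hin hr hp2 hadd hT _ ↦ h W p hCM hin hr hp2 hadd hT⟩

end Summit.BirchSwinnertonDyer.BirchSwinnertonDyer.Theorems.InertBadOffTprime

end
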